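import Literature.MathematicalPhysics.QuantumFieldTheory.Balaban1983to89.B9Eq310HessianOperator
import Literature.MathematicalPhysics.QuantumFieldTheory.TorusChartFlatCochains

/-!
# `Balaban1983to89.B5Eq172PoincareTorus` — T. Bałaban, *Propagators and renormalization transformations for lattice gauge theories. I*,
# Commun. Math. Phys. **95** (1984) 17–40 [Balaban1984PropagatorsI] ("B5") p. 30, the sentence after (1.72): «From the first equation we get
# A = ∂(…)ω + A₀ where A₀ is a constant vector function» — THE TORUS POINCARÉ LEMMA («a curl-free bond field is a gradient plus a constant
# vector function») FOR THE pub-balaban NE9 CHAIN'S PERIODIC LATTICE `TSite d Pd = Π_i ℤ/P_iℤ` and its curl/gradient (3.4)/(3.3) of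
# [Balaban1985BackgroundPropagators] at the FLAT background — hypothesis (H1) of `B5Eq172HodgePositivity` DISCHARGED, together with (H4)
# «coarse gradients ⊥ constants» and p. 22 «a function with zero gradient is constant»

statement-level skeleton of published theorems with citation tags; proofs where landed; nothing here is a claim
about the Yang–Mills mass gap

PDF held: `paper:balaban1984-cmp95-propagators-rt-i` (journal page = PDF page + 16), pp. 22, 30; `paper:balaban1985-cmp99-background-propagators`
(journal page = PDF page + 388), pp. 390–392; read by this seat (2026-08-21) in the held text layers.

THE PRINT (verbatim).  [B5] p. 30: *«Thus if for some A we have Δ_aA = 0, then ΔA − dPd*A = 0, QA = 0. (1.72) From the first equation we get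
A = ∂Δ⁻²Q′*(Q′Δ⁻²Q′*)⁻¹ω + A₀ where A₀ is a constant vector function and ω is a function on unit lattice T₁^{(k)} orthogonal to constant
functions.»*  p. 22: *«Now we use spectral properties of the Laplace operator Δ on the torus T_η. It is a symmetric, non-negative operator, and 0
is its eigenvalue. Constant functions form the eigenspace corresponding to the eigenvalue 0»*.  p. 27: *«It implies that ω is orthogonal to
constant functions.»*  [B9] (3.3) p. 391 *«(D^η_{U₀}A)(b) = η⁻¹(R(U₀(b))A(b₊) − A(b₋))»*, (3.4) p. 391, (3.8) p. 392.

WHY THIS FILE (cell context).  `B5Eq172HodgePositivity` (pub-balaban NE9 owner, gen 79) proves the positivity of the NE9 chain's principal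
gauge-fixed operator `Δ_a(1) = D*D + DR(1)D* + aQ(1)*Q(1)` at the flat background from a HODGE PACKAGE (H0)–(H5) displayed as hypotheses.
This file discharges the purely lattice-geometric members for the chain's own carriers (`B4Sect5Torus.TSite`, `B9SectCLatticeCarrier.{shift,
Bond, Plaq}`, `B9Eq33CovDerivVector.covDeriv`/`covDiv`, `B9Eq34CovCurlVector.covCurl`, their `L²` readings `covDerivL2K`/`covCurlL2K`): (H1) the
Poincaré lemma, (H4), and the connectivity fact behind (H5).  MECHANISM: the structure theorem for flat `1`-cochains on a charted torus
(`TorusChartFlatCochains.eq_d₀_prim_add_seam_wind`, `exists_d₀_eq_iff`: flat = gradient + seam cochain of the winding vector; zero winding ⇔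
gradient) applied through a TORUS CHART OF `TSite d Pd` (unit translations `Pi.single i 1`, coordinates `(x i).val`; the chain's `shift` IS
`+ e_i`), plus the observation that over a field of characteristic zero the seam cochain of `w` is cohomologous to the CONSTANT field `w_μ/P_μ`
(same winding vector).

WHAT IS DEFINED AND PROVED (sorry-free; no `Prop` placeholder; no inequality of the papers).
* §1 **`chartT Pd : TorusChart (TSite d Pd) d`** (`P_i ≥ 1`); `shift_eq_add_gen` (`B9SectCLatticeCarrier.shift μ x = x + e_μ`).
* §2 the dictionary at a FLAT transporter (`R b = id` for all `b`): `covDeriv_eq_smul_d₀` (`(Df)(x,μ) = c·d₀f`), `covCurl_eq_smul_d₁` (`(DA)(p_{μν}(x)) =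
  c·d₁θ_A`), `isFlat_of_covCurl_eq_zero`.
* §3 constant vector functions: `constBond v = (b ↦ v_{b.2})` is flat with winding vector `(P_μ • v_μ)_μ` (`isFlat_const`, `wind_const`); p. 22
  **`const_of_covDeriv_eq_zero`** (`Df = 0 ⇒ f` constant).
* §4 **`exists_eq_covDeriv_add_const`** (THE POINCARÉ LEMMA, p. 30): over a field of characteristic zero, `c ≠ 0`, flat transporter: `covCurl c R A = 0
  ⇒ A = covDeriv c R f + constBond v` for some site function `f` and `v : Fin d → V`.
* §5 on the chain's `L²` spaces (`𝕜` = `RCLike`): `constBondL2K` (the constants read in `BondL2K`), **`hodge_flat`** = hypothesis (H1) of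
  `B5Eq172HodgePositivity.exists_coercive_principal_flat_of_hodge` with `Harm := LinearMap.range (constBondL2K …)`: `covCurlL2K c R x = 0 ⇒
  x = covDerivL2K c R l + h`, `h ∈ Harm`; **`inner_covDerivL2K_const`** = (H4): `⟨Dω, h⟩ = 0` for constant `h` (via `D* = D†`,
  `B11Eq103H1Complex.adjoint_covDerivL2K`, and `D*` of a constant `= 0`); `covDerivL2K_const` (`D` of a constant site function `= 0`).
MODEL / DECLARED READINGS.  (M1) `TSite d Pd = Π_i Fin (P_i)` with its product group structure (`Fin.addCommGroup`); the chart's `e_i = Pi.single i 1`.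
(M2) «flat transporter» = `∀ b, R b = LinearMap.id` (the chain's `adTransportW φ 1`, `B5Eq172HodgePositivity.adTransportW_one`).  (M3) NOT HERE:
(H2) (1.55), (H3), (H5)'s averaging half (`Q′(1)` of a constant) — they concern [Balaban1985Averaging]'s `linQcov`/`Qprime` at `V₀ = 1`, sequel.
HONEST SCOPE.  [folklore] discrete exterior calculus on a finite torus (the cited sentences are print's use of it); no estimate; NOT summit progress
(cell pub-balaban: NE9 NOT PRINTED / NOT PROVED; spine PROVED 0/9).  Filed by the pub-balaban NE9 BINDER-row owner lineage `b2b-balaban-t4-ne9-p1`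
(gen 79); NEW file importing `B9Eq310HessianOperator` and `TorusChartFlatCochains`; nothing modified.  Net new unproved facts: 0.
-/

noncomputable section

open scoped InnerProductSpace ComplexConjugate BigOperators

namespace Literature.MathematicalPhysics.QuantumFieldTheory.Balaban1983to89.B5Eq172PoincareTorus

open Literature.MathematicalPhysics.QuantumFieldTheory (TorusChart)
open B4Sect5Torus (TSite)
open B9SectCLatticeCarrier (Bond Plaq DirPair shift unshift shift_apply_val shift_apply_ne)
open B9Eq33CovDerivVector (covDeriv covDeriv_apply_dir covDiv covDiv_apply)
open B9Eq34CovCurlVector (covCurl covCurl_apply_coord)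
open B9Eq311L2Pairing (WL2)
open B11Eq103H1Complex (SiteL2K BondL2K covDerivL2K covDivL2K adjoint_covDerivL2K equiv_covDerivL2K equiv_covDivL2K)
open B9Eq310HessianOperator (covCurlL2K equiv_covCurlL2K)

variable {d : ℕ} {Pd : Fin d → ℕ} [∀ i, NeZero (Pd i)]

/-! ## §1 The torus chart of `TSite d Pd = Π_i ℤ/P_iℤ` -/

variable (Pd) in
/-- **The torus chart of the NE9 chain's periodic lattice `Π_i Fin (P_i)`**: periods `P_i`, unit translations `e_i = Pi.single i 1`, coordinates
`(x i).val` — so that the discrete exterior calculus of `TorusChartCochains`/`TorusChartFlatCochains` applies to the carriers of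
[Balaban1985BackgroundPropagators] (3.3)–(3.4). [folklore] -/
def chartT : TorusChart (TSite d Pd) d where
  period := Pd
  gen := fun i => Pi.single i 1
  cval := fun i x => (x i).val
  cval_lt := fun i x => (x i).isLt
  cval_zero := fun i => rfl
  cval_add_gen_self := fun i x => by
    rw [Pi.add_apply, Pi.single_eq_same, Fin.val_add, Fin.val_one', Nat.add_mod_mod]
  cval_add_gen_of_ne := fun {i j} x hij => by rw [Pi.add_apply, Pi.single_eq_of_ne hij, add_zero]
  ext_cval := fun {x y} h => funext fun i => Fin.ext (h i)

/-- The periods of the chart are the `P_i` (the periodic lattice of (3.3)–(3.4)). [cite: Balaban1985BackgroundPropagators, (3.3) p.391] -/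
@[simp] theorem chartT_period (i : Fin d) : (chartT Pd).period i = Pd i := rfl

/-- The unit translations `e_i` of the chart (the steps `b₊ = b₋ + ηe_μ` of (3.3)). [cite: Balaban1985BackgroundPropagators, (3.3) p.391] -/
@[simp] theorem chartT_gen (i : Fin d) : (chartT Pd).gen i = Pi.single i 1 := rfl

/-- **The chain's forward step `shift μ` IS the chart's translation `x ↦ x + e_μ`.** [cite: Balaban1985BackgroundPropagators, (3.3) p.391] -/
theorem shift_eq_add_gen (μ : Fin d) (x : TSite d Pd) : shift μ x = x + (chartT Pd).gen μ := by
  funext i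
  by_cases h : i = μ
  · subst h
    apply Fin.ext
    rw [shift_apply_val, chartT_gen, Pi.add_apply, Pi.single_eq_same, Fin.val_add, Fin.val_one', Nat.add_mod_mod]
  · rw [shift_apply_ne h, chartT_gen, Pi.add_apply, Pi.single_eq_of_ne h, add_zero]

/-! ## §2 The dictionary at a flat transporter: (3.3) is `c·d₀`, (3.4) is `c·d₁` -/

section Dictionary

variable {𝕜 : Type*} [CommRing 𝕜] {V : Type*} [AddCommGroup V] [Module 𝕜 V] (c : 𝕜) {R : Bond d Pd → V →ₗ[𝕜] V}
  (hR : ∀ b, R b = LinearMap.id)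
include hR

/-- **(3.3) at a flat transporter is `c` times the chart's coboundary `d₀`.** [cite: Balaban1985BackgroundPropagators, (3.3) p.391] -/
theorem covDeriv_eq_smul_d₀ (f : TSite d Pd → V) (x : TSite d Pd) (μ : Fin d) :
    covDeriv c R f (x, μ) = c • (chartT Pd).d₀ f x μ := by
  rw [covDeriv_apply_dir, hR, LinearMap.id_apply, TorusChart.d₀_apply, shift_eq_add_gen]

/-- **(3.4) at a flat transporter is `c` times the chart's coboundary `d₁`** of the cochain `θ_A(x, μ) = A(x, μ)`.
[cite: Balaban1985BackgroundPropagators, (3.4) p.391] -/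
theorem covCurl_eq_smul_d₁ (A : Bond d Pd → V) (x : TSite d Pd) (q : DirPair d) :
    covCurl c R A (x, q) = c • (chartT Pd).d₁ (fun y μ => A (y, μ)) x q.1.1 q.1.2 := by
  rw [covCurl_apply_coord, hR, hR, LinearMap.id_apply, LinearMap.id_apply, TorusChart.d₁_apply, shift_eq_add_gen, shift_eq_add_gen,
    ← smul_sub]
  congr 1
  abel

end Dictionary

section Flat

variable {𝕜 : Type*} [Field 𝕜] {V : Type*} [AddCommGroup V] [Module 𝕜 V] {c : 𝕜} (hc : c ≠ 0) {R : Bond d Pd → V →ₗ[𝕜] V}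
  (hR : ∀ b, R b = LinearMap.id)
include hc hR

/-- **A curl-free bond function is a FLAT cochain** (all plaquette circulations vanish, in either orientation).
[cite: Balaban1985BackgroundPropagators, (3.4) p.391; Balaban1984PropagatorsI, (1.72) p.30] -/
theorem isFlat_of_covCurl_eq_zero {A : Bond d Pd → V} (h : covCurl c R A = 0) : (chartT Pd).IsFlat (fun y μ => A (y, μ)) := by
  intro x i j
  rcases lt_trichotomy i j with hij | rfl | hji
  · have hp := congr_fun h (x, ⟨(i, j), hij⟩)
    rw [covCurl_eq_smul_d₁ c hR, Pi.zero_apply] at hp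
    exact (smul_eq_zero.1 hp).resolve_left hc
  · exact (chartT Pd).d₁_self _ _ _
  · have hp := congr_fun h (x, ⟨(j, i), hji⟩)
    rw [covCurl_eq_smul_d₁ c hR, Pi.zero_apply] at hp
    rw [(chartT Pd).d₁_swap _ x j i, (smul_eq_zero.1 hp).resolve_left hc, neg_zero]

end Flat

/-! ## §3 Constant vector functions: flat, with winding vector `(P_μ • v_μ)_μ`; p. 22: zero gradient ⇒ constant -/

section Const

variable {V : Type*}

omit [∀ i, NeZero (Pd i)] in
/-- **«A₀ is a constant vector function»**: the bond function `b ↦ v_{μ(b)}` of a vector `v : Fin d → V`. [cite: Balaban1984PropagatorsI, (1.72) p.30] -/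
def constBond (v : Fin d → V) : Bond d Pd → V := fun b => v b.2

omit [∀ i, NeZero (Pd i)] in
/-- Unfolding. [cite: Balaban1984PropagatorsI, (1.72) p.30] -/
@[simp] theorem constBond_apply (v : Fin d → V) (b : Bond d Pd) : constBond v b = v b.2 := rfl

variable [AddCommGroup V]

/-- A constant vector function («A₀ is a constant vector function», p. 30) is a flat cochain (curl-free). [cite: Balaban1984PropagatorsI, (1.72) p.30] -/
theorem isFlat_const (v : Fin d → V) : (chartT Pd).IsFlat (fun (_ : TSite d Pd) μ => v μ) := by
  intro x i j
  rw [TorusChart.d₁_apply]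
  abel

/-- The winding vector of a constant vector function: `wind (v) μ = P_μ • v_μ` (its sum around the `μ`-th axis loop of the torus). [cite: Balaban1984PropagatorsI, (1.72) p.30] -/
theorem wind_const (v : Fin d → V) (μ : Fin d) : (chartT Pd).wind (fun (_ : TSite d Pd) ν => v ν) μ = Pd μ • v μ := by
  rw [TorusChart.wind_eq, TorusChart.lineSum, Finset.sum_const, Finset.card_range, chartT_period]

/-- **p. 22 «Constant functions form the eigenspace corresponding to the eigenvalue 0»** in the form used here: over a field, a site function
with ZERO (flat) GRADIENT (3.3), `c ≠ 0`, is constant — the torus is connected by unit steps (`TorusChart.d₀_eq_zero_iff`).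
[cite: Balaban1984PropagatorsI, p.22] -/
theorem const_of_covDeriv_eq_zero {𝕜 : Type*} [Field 𝕜] [Module 𝕜 V] {c : 𝕜} (hc : c ≠ 0) {R : Bond d Pd → V →ₗ[𝕜] V}
    (hR : ∀ b, R b = LinearMap.id) {f : TSite d Pd → V} (h : covDeriv c R f = 0) (x : TSite d Pd) : f x = f 0 := by
  have hd : (chartT Pd).d₀ f = 0 := by
    funext y μ
    have hb := congr_fun h (y, μ)
    rw [covDeriv_eq_smul_d₀ c hR, Pi.zero_apply] at hb
    exact (smul_eq_zero.1 hb).resolve_left hc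
  exact ((chartT Pd).d₀_eq_zero_iff f).1 hd x

variable {𝕜 : Type*} [CommRing 𝕜] [Module 𝕜 V]

/-- `D` of a constant site function vanishes (flat transporter). [cite: Balaban1985BackgroundPropagators, (3.3) p.391] -/
theorem covDeriv_const (c : 𝕜) {R : Bond d Pd → V →ₗ[𝕜] V} (hR : ∀ b, R b = LinearMap.id) (v : V) :
    covDeriv c R (fun _ : TSite d Pd => v) = 0 := by
  funext b
  obtain ⟨x, μ⟩ := b
  rw [covDeriv_eq_smul_d₀ c hR, TorusChart.d₀_apply, sub_self, smul_zero, Pi.zero_apply]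

omit [∀ i, NeZero (Pd i)] in
/-- `D*` ((3.8), flat adjoint transporter) of a constant vector function vanishes: every term `S(b)A(x − e_μ, μ) − A(x, μ)` is `v_μ − v_μ`.
[cite: Balaban1985BackgroundPropagators, (3.8) p.392; Balaban1984PropagatorsI, p.27] -/
theorem covDiv_constBond (c : 𝕜) {S : Bond d Pd → V →ₗ[𝕜] V} (hS : ∀ b, S b = LinearMap.id) (v : Fin d → V) :
    covDiv c S (constBond (Pd := Pd) v) = 0 := by
  funext y
  rw [covDiv_apply, Pi.zero_apply]
  simp only [hS, LinearMap.id_apply, constBond_apply, sub_self, Finset.sum_const_zero, smul_zero]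

end Const

/-! ## §4 p. 30: THE POINCARÉ LEMMA — a curl-free bond function is a gradient plus a constant vector function -/

section Poincare

variable {𝕜 : Type*} [Field 𝕜] [CharZero 𝕜] {V : Type*} [AddCommGroup V] [Module 𝕜 V] {c : 𝕜} (hc : c ≠ 0)
  {R : Bond d Pd → V →ₗ[𝕜] V} (hR : ∀ b, R b = LinearMap.id)
include hc hR

/-- **«From the first equation we get A = ∂(…) + A₀ where A₀ is a constant vector function»** — THE TORUS POINCARÉ LEMMA for the chain's
carriers: over a field of characteristic zero, with `c ≠ 0` and a flat transporter, a CURL-FREE bond function (`covCurl c R A = 0`) is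
`covDeriv c R f + constBond v`.  Proof: `θ_A` is flat, so `θ_A = d₀(prim) + seam(wind θ_A)` (`TorusChartFlatCochains`); the constant field
`v_μ := P_μ⁻¹ • wind θ_A μ` is flat with the SAME winding vector, hence `θ_A − v` is a gradient `d₀ g`, and `A = D(c⁻¹g) + constBond v`.
[cite: Balaban1984PropagatorsI, (1.72) p.30] -/
theorem exists_eq_covDeriv_add_const {A : Bond d Pd → V} (h : covCurl c R A = 0) :
    ∃ (f : TSite d Pd → V) (v : Fin d → V), A = covDeriv c R f + constBond v := by
  set θ : TSite d Pd → Fin d → V := fun y μ => A (y, μ) with hθ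
  have hflat : (chartT Pd).IsFlat θ := isFlat_of_covCurl_eq_zero hc hR h
  -- the constant field with the same winding vector
  set v : Fin d → V := fun μ => ((Pd μ : 𝕜))⁻¹ • (chartT Pd).wind θ μ with hv
  have hvflat : (chartT Pd).IsFlat (fun (_ : TSite d Pd) μ => v μ) := isFlat_const v
  have hvwind : (chartT Pd).wind (fun (_ : TSite d Pd) μ => v μ) = (chartT Pd).wind θ := by
    funext μ
    have hP : ((Pd μ : 𝕜)) ≠ 0 := Nat.cast_ne_zero.2 (NeZero.ne _)
    rw [wind_const, hv, ← Nat.cast_smul_eq_nsmul 𝕜, smul_smul, mul_inv_cancel₀ hP, one_smul]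
  -- the difference is flat with zero winding, hence a gradient
  obtain ⟨g, hg⟩ := ((chartT Pd).exists_d₀_eq_iff (θ - fun _ μ => v μ)).2
    ⟨hflat.sub hvflat, by rw [TorusChart.wind_sub, hvwind, sub_self]⟩
  refine ⟨c⁻¹ • g, v, funext fun b => ?_⟩
  obtain ⟨x, μ⟩ := b
  have hpt := congr_fun (congr_fun hg x) μ
  simp only [Pi.sub_apply] at hpt
  rw [Pi.add_apply, constBond_apply, covDeriv_eq_smul_d₀ c hR, TorusChart.d₀_apply, Pi.smul_apply, Pi.smul_apply, ← smul_sub, smul_smul,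
    mul_inv_cancel₀ hc, one_smul, ← TorusChart.d₀_apply, ← hpt, hθ, sub_add_cancel]

end Poincare

/-! ## §5 On the chain's `L²` spaces: (H1) and (H4) of `B5Eq172HodgePositivity`, and `D` of a constant -/

section L2

variable (𝕜 : Type*) [RCLike 𝕜] {W : Type*} [NormedAddCommGroup W] [InnerProductSpace 𝕜 W] (c₀ : ℝ)

omit [∀ i, NeZero (Pd i)] in
variable (Pd) in
/-- **The constant vector functions READ IN the `L²` bond space** `BondL2K` (the submodule `Harm := range constBondL2K` of (H1)/(H3)).
[cite: Balaban1984PropagatorsI, (1.72) p.30] -/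
def constBondL2K : (Fin d → W) →ₗ[𝕜] BondL2K 𝕜 d Pd c₀ W :=
  (WL2.linearEquiv 𝕜 𝕜 (fun _ : Bond d Pd => c₀)).symm.toLinearMap ∘ₗ LinearMap.funLeft 𝕜 W (Prod.snd : Bond d Pd → Fin d)

variable {𝕜 c₀}

omit [∀ i, NeZero (Pd i)] in
/-- Unfolding: the function underlying `constBondL2K v` is `constBond v`. [cite: Balaban1984PropagatorsI, (1.72) p.30] -/
@[simp] theorem equiv_constBondL2K (v : Fin d → W) : WL2.equiv 𝕜 _ W (constBondL2K Pd 𝕜 c₀ v) = constBond v := rfl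

/-- A constant vector function vanishes only if its vector does (the torus has a site) — «A₀ = 0», p. 30. [cite: Balaban1984PropagatorsI, (1.72) p.30] -/
theorem eq_zero_of_constBondL2K_eq_zero {v : Fin d → W} (h : constBondL2K Pd 𝕜 c₀ v = 0) : v = 0 := by
  funext κ
  have hb := congr_fun (congrArg (WL2.equiv 𝕜 (fun _ : Bond d Pd => c₀) W) h) ((fun _ => 0 : TSite d Pd), κ)
  rwa [equiv_constBondL2K, constBond_apply, WL2.equiv_zero] at hb

variable [Fact (0 < c₀)] {c : 𝕜} {R : Bond d Pd → W →ₗ[𝕜] W}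

/-- **(H1) OF `B5Eq172HodgePositivity` DISCHARGED: the Poincaré lemma on the `L²` bond space** — `covCurlL2K c R x = 0` (flat transporter,
`c ≠ 0`) gives `x = covDerivL2K c R l + h` with `h ∈ range constBondL2K`. [cite: Balaban1984PropagatorsI, (1.72) p.30] -/
theorem hodge_flat (hc : c ≠ 0) (hR : ∀ b, R b = LinearMap.id) (x : BondL2K 𝕜 d Pd c₀ W) (hx : covCurlL2K 𝕜 c₀ c R x = 0) :
    ∃ l : SiteL2K 𝕜 d Pd c₀ W, ∃ h ∈ LinearMap.range (constBondL2K Pd 𝕜 c₀), x = covDerivL2K 𝕜 c₀ c R l + h := by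
  have hx' : covCurl c R (WL2.equiv 𝕜 _ W x) = 0 := by rw [← equiv_covCurlL2K, hx]; rfl
  obtain ⟨f, v, hfv⟩ := exists_eq_covDeriv_add_const hc hR hx'
  refine ⟨(WL2.equiv 𝕜 _ W).symm f, constBondL2K Pd 𝕜 c₀ v, LinearMap.mem_range_self _ v, ?_⟩
  apply (WL2.equiv 𝕜 (fun _ : Bond d Pd => c₀) W).injective
  rw [hfv, WL2.equiv_add, equiv_covDerivL2K, equiv_constBondL2K, Equiv.apply_symm_apply]

/-- `D` of a constant site function vanishes on the `L²` spaces (flat transporter) — the `Dκ = 0` half of (H5).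
[cite: Balaban1985BackgroundPropagators, (3.3) p.391] -/
theorem covDerivL2K_const (c : 𝕜) (hR : ∀ b, R b = LinearMap.id) (v : W) :
    covDerivL2K 𝕜 c₀ c R ((WL2.equiv 𝕜 (fun _ : TSite d Pd => c₀) W).symm fun _ => v) = 0 := by
  apply (WL2.equiv 𝕜 (fun _ : Bond d Pd => c₀) W).injective
  rw [equiv_covDerivL2K, Equiv.apply_symm_apply, covDeriv_const c hR, WL2.equiv_zero]

variable [FiniteDimensional 𝕜 W]

omit [∀ i, NeZero (Pd i)] in
/-- **(H4) OF `B5Eq172HodgePositivity` DISCHARGED: gradients are orthogonal to the constant vector functions** («ω is orthogonal to constant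
functions», [B5] p. 27/30): `⟨Dω, h⟩ = 0` for `h ∈ range constBondL2K` — via `D* = D†` (`conj c = c`, flat transporters) and `D*` of a
constant `= 0`. [cite: Balaban1984PropagatorsI, p.27, (1.72) p.30; Balaban1985BackgroundPropagators, (3.8) p.392] -/
theorem inner_covDerivL2K_const (hc : conj c = c) (hR : ∀ b, R b = LinearMap.id) {S : Bond d Pd → W →ₗ[𝕜] W} (hS : ∀ b, S b = LinearMap.id)
    (ω : SiteL2K 𝕜 d Pd c₀ W) (h : BondL2K 𝕜 d Pd c₀ W) (hh : h ∈ LinearMap.range (constBondL2K Pd 𝕜 c₀)) :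
    ⟪covDerivL2K 𝕜 c₀ c R ω, h⟫_𝕜 = 0 := by
  obtain ⟨v, rfl⟩ := hh
  have hRS : ∀ (b : Bond d Pd) (u w : W), ⟪R b u, w⟫_𝕜 = ⟪u, S b w⟫_𝕜 := fun b u w => by rw [hR, hS, LinearMap.id_apply, LinearMap.id_apply]
  have hdiv : covDivL2K 𝕜 c₀ c S (constBondL2K Pd 𝕜 c₀ v) = 0 := by
    apply (WL2.equiv 𝕜 (fun _ : TSite d Pd => c₀) W).injective
    rw [equiv_covDivL2K, equiv_constBondL2K, covDiv_constBond c hS, WL2.equiv_zero]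
  rw [← LinearMap.adjoint_inner_right, adjoint_covDerivL2K c hc R S hRS, hdiv, inner_zero_right]

end L2

end Literature.MathematicalPhysics.QuantumFieldTheory.Balaban1983to89.B5Eq172PoincareTorus

end
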